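import Summits.ResolutionOfSingularities.ResolutionOfSingularities.Theses.Dominance
import Literature.AlgebraicGeometry.Resolution.ProperModelsPatching
import Literature.AlgebraicGeometry.Resolution.ProperModelsExtensionOverField
import Literature.AlgebraicGeometry.Resolution.ProperModelsPatchingGluing
import Literature.AlgebraicGeometry.Resolution.SandwichedWeakPatching
import Literature.AlgebraicGeometry.Resolution.ProjectiveModelsCharts
import Literature.AlgebraicGeometry.Resolution.GraphClosureCompactification
import Literature.AlgebraicGeometry.Resolution.ComponentGluing
import HarnessLib

/-!
# Domination by patching — `TwoModelPatching ⟹ Dominance.SandwichedResolve`, kernel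

Cell `decomp-res`, lens 4, generation 2: ORDER CERTIFICATE for the residual `MR` of route
`Dominance` (item stmt-ResolutionOfSingularities-24572; refines
route-ResolutionOfSingularities-Dominance:SandwichedResolve) against census class E2
(`ProperModel.TwoModelPatching`, Piltant 2013 Prop. 5.1, the open conjunct of the tree's Zariski
bisection KERNEL `ProperModel.resolutionInChar_iff_twoModelPatching_and_regModel`, census v2 row A7).

MAIN THEOREM `sandwichedResolve_of_twoModelPatching`:
`NagataCompactification.{0} → (∀ p, p.Prime → ProperModel.TwoModelPatching.{0} p) →
Dominance.SandwichedResolve` (item 24572 VERBATIM; 0 sorry; axioms {propext, Classical.choice,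
Quot.sound}).  Stages: `hasResolution_sandwiched_of_twoModelPatching` (one prime, integral regular base),
then the clopen component decomposition of a regular base (`Scheme.IsRegular.coe_irreducibleComponentOpen`,
`hasResolution_sup_of_disjoint`).  Hence:

  **E2 = TwoModelPatching ⟹ MR (mod the named fact NagataCompactification)** — the domination side of
  `Dominance` is DOMINATED by the patching conjunct of A7; no regular model (RegModel / RR) is needed,
  because the regular base `Y`, compactified, serves as the second model and RegLe-ness is only used
  over `Y`.  With the tree's `ProperModel.twoModelPatching_of_resolutionInChar` this reads
  MR ≤ E2 ≤ S (all kernel); no converse E2 ⟸ MR is known; strictness is not certified anywhere.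
  LANDABLE as a Theorems file supporting item 24572 (suggested target
  `Summits/ResolutionOfSingularities/ResolutionOfSingularities/Theorems/DominanceOfTwoModelPatching.lean`,
  `--supports stmt-ResolutionOfSingularities-24572`; the planner seat does not propose proofs).

Proof: compactify `Y ⊂ Ȳ` and `Γ ⊂ Γ̄ → Ȳ` (Nagata + graph closure, integral), present both as proper
models of `K = Frac Γ(W)` for an affine `W ⊂ b⁻¹(U) ⊂ Γ` on which `b` is an open immersion, apply
two-model patching to `(Γ̄, Ȳ)`, identify the two dominations (`ProperModel.Hom.f_eq`), and restrict the
patch `N → Γ̄` over `Γ`: its source is regular there because `N → Ȳ` is `RegLe` and `Γ` maps into the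
regular open `Y ⊂ Ȳ`.
-/

set_option linter.dupNamespace false

noncomputable section

namespace Summit.ResolutionOfSingularities.ResolutionOfSingularities.Theorems.DominanceOfTwoModelPatching

open CategoryTheory CategoryTheory.Limits AlgebraicGeometry TopologicalSpace
open Literature.AlgebraicGeometry.Resolution Literature.AlgebraicGeometry.Morphisms
open Literature.AlgebraicGeometry.Resolution.SandwichedGluing
open Summit.ResolutionOfSingularities.ResolutionOfSingularities.Theses

universe u

/-! ## Proper models from a chart -/

section OfChart

variable {k K : Type u} [Field k] [Field K] [Algebra k K]
  (X : Scheme.{u}) [IsIntegral X] (πX : X ⟶ Spec (.of k)) [IsProper πX]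
  (A : Type u) [CommRing A] [IsDomain A] [Algebra k A] [Algebra A K] [IsScalarTower k A K]
  [IsFractionRing A K]
  (j : Spec (.of A) ⟶ X) [IsOpenImmersion j]
  (hj : j ≫ πX = Spec.map (CommRingCat.ofHom (algebraMap k A)))

/-- A proper integral `k`-scheme with an affine chart `Spec A ↪ X`, `Frac A = K`, is a proper model
of `K/k` (the proper analogue of `ProjModel.ofChart`). -/
def properModelOfChart : ProperModel k K where
  X := X
  π := πX
  gen := Spec.map (CommRingCat.ofHom (algebraMap A K)) ≫ j
  gen_π := by
    rw [Category.assoc, hj, ← Spec.map_comp, ← CommRingCat.ofHom_comp,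
      ← IsScalarTower.algebraMap_eq]
  isIntegral := ‹_›
  isProper := ‹_›
  genericPt_eq := by
    rw [Scheme.Hom.comp_apply, specMap_closedPoint_eq_genericPoint A K
      (IsFractionRing.injective A K)]
    exact genericPoint_eq_of_isOpenImmersion j
  isIso_stalkClosedPointTo := by
    rw [Scheme.stalkClosedPointTo_comp]
    have h : ∀ x, IsIso (j.stalkMap x) := fun x => inferInstance
    exact IsIso.comp_isIso' (h _) (isIso_stalkClosedPointTo_of_isFractionRing A K)

end OfChart

/-! ## Integral relative compactification (Nagata over a field + graph closure) -/

/-- Integral form of `exists_compactification_of_nagata_over_field`: a separated finite-type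
`f : Y → X` from an INTEGRAL `Y` to a separated finite-type `k`-scheme `X` factors as an open immersion
into an INTEGRAL `X̄` followed by a proper `X̄ → X`. -/
theorem exists_integral_compactification_over {k : Type u} [Field k]
    (hN : ∀ (Y : Scheme.{u}) [IsIntegral Y] (f : Y ⟶ Spec (.of k)) [IsSeparated f]
      [LocallyOfFiniteType f] [QuasiCompact f],
      ∃ (Yc : Scheme.{u}) (j : Y ⟶ Yc) (g : Yc ⟶ Spec (.of k)),
        IsOpenImmersion j ∧ IsProper g ∧ j ≫ g = f)
    {X Y : Scheme.{u}} [IsIntegral Y] (πX : X ⟶ Spec (.of k))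
    [IsSeparated πX] [LocallyOfFiniteType πX] [QuasiCompact πX]
    (f : Y ⟶ X) [IsSeparated f] [LocallyOfFiniteType f] [QuasiCompact f] :
    ∃ (Xc : Scheme.{u}) (j : Y ⟶ Xc) (g : Xc ⟶ X),
      IsIntegral Xc ∧ IsOpenImmersion j ∧ IsProper g ∧ j ≫ g = f := by
  obtain ⟨N, j₀, gN, hj₀, hgN, hfac⟩ := hN Y (f ≫ πX)
  haveI := hj₀
  haveI := hgN
  haveI : IsLocallyNoetherian Y := LocallyOfFiniteType.isLocallyNoetherian (f ≫ πX)
  haveI : CompactSpace Y := QuasiCompact.compactSpace_of_compactSpace (f ≫ πX)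
  haveI : IsNoetherian Y := {}
  let γ : Y ⟶ pullback gN πX := pullback.lift j₀ f hfac
  have hγ : γ ≫ pullback.fst gN πX = j₀ := pullback.lift_fst _ _ _
  obtain ⟨Y', c, s, hY', hc, hsc, hs, -, -⟩ :=
    exists_graphClosure_compactification j₀ (pullback.fst gN πX) γ hγ
  haveI := hc
  refine ⟨Y', s, c ≫ pullback.snd gN πX, hY', hs, inferInstance, ?_⟩
  rw [← Category.assoc, hsc]
  exact pullback.lift_snd _ _ _

/-! ## The theorem -/

/-- **Two-model patching resolves an integral scheme sandwiched over an integral regular base**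
(no regular proper model needed). -/
theorem hasResolution_sandwiched_of_twoModelPatching (hN : NagataCompactification.{u})
    {p : ℕ} (hT : ProperModel.TwoModelPatching.{u} p) {k : Type u} [Field k] [CharP k p]
    {Y : Scheme.{u}} (g : Y ⟶ Spec (.of k)) [IsSeparated g] [LocallyOfFiniteType g]
    [QuasiCompact g] [IsIntegral Y] (hY : Scheme.IsRegular Y) {Γ : Scheme.{u}} (b : Γ ⟶ Y)
    [IsSeparated b] [LocallyOfFiniteType b] [QuasiCompact b] [IsIntegral Γ]
    (hb : IsBirational b) : Scheme.HasResolution Γ := by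
  classical
  have hNk := nagata_over_field_of_nagataCompactification hN k
  -- (1) an integral compactification `Y ⊂ Ȳ` over `k`
  obtain ⟨Yb, sY, πYb, hYb, hsY, hπYb, hfacY⟩ := exists_integral_compactification hN Y g
  haveI := hYb
  haveI := hsY
  haveI := hπYb
  -- (2) an integral compactification `Γ ⊂ Γ̄ → Ȳ` of `Γ → Y ⊂ Ȳ`
  haveI : IsLocallyNoetherian Γ := LocallyOfFiniteType.isLocallyNoetherian (b ≫ g)
  haveI : CompactSpace Γ := QuasiCompact.compactSpace_of_compactSpace (b ≫ g)
  haveI : IsNoetherian Γ := {}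
  obtain ⟨Γb, jΓ, c, hΓb, hjΓ, hc, hfacΓ⟩ :=
    exists_integral_compactification_over hNk πYb (b ≫ sY)
  haveI := hΓb
  haveI := hjΓ
  haveI := hc
  let πΓb : Γb ⟶ Spec (.of k) := c ≫ πYb
  haveI : IsProper πΓb := inferInstance
  -- (3) a common affine chart `W ⊂ b⁻¹(U) ⊂ Γ` on which `b` is an open immersion
  obtain ⟨U, hUd, hbUd, hUiso⟩ := hb
  haveI := hUiso
  have hne : ((b ⁻¹ᵁ U : Γ.Opens) : Set Γ).Nonempty := hbUd.nonempty
  obtain ⟨x, hx⟩ := hne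
  obtain ⟨_, ⟨W₀, hW₀, rfl⟩, hxW, hWU₀⟩ :=
    Γ.isBasis_affineOpens.exists_subset_of_mem_open hx (b ⁻¹ᵁ U).isOpen
  let W : Γ.Opens := W₀
  have hW : IsAffineOpen W := hW₀
  have hWU : W ≤ b ⁻¹ᵁ U := hWU₀
  haveI : IsAffine (W : Scheme.{u}) := hW
  haveI : Nonempty (W : Scheme.{u}) := ⟨⟨x, hxW⟩⟩
  let A : Type u := Γ(W, ⊤)
  let gW : (W : Scheme.{u}) ⟶ Spec (.of k) := W.ι ≫ b ≫ g
  let ψ : k →+* A := gW.appTop.hom.comp (Scheme.ΓSpecIso (.of k)).inv.hom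
  have hψ : ψ.FiniteType := by
    have h1 : gW.appTop.hom.FiniteType :=
      (HasRingHomProperty.iff_of_isAffine (P := @LocallyOfFiniteType)).mp inferInstance
    exact h1.comp (RingHom.FiniteType.of_surjective _
      (Scheme.ΓSpecIso (.of k)).symm.commRingCatIsoToRingEquiv.surjective)
  letI : Algebra k A := ψ.toAlgebra
  haveI hft : Algebra.FiniteType k A := hψ
  let K : Type u := FractionRing A
  haveI : Algebra.EssFiniteType k K := inferInstance
  let ιW : Spec (.of A) ⟶ Γ := (W : Scheme.{u}).isoSpec.inv ≫ W.ι
  have hιW : ιW ≫ b ≫ g = Spec.map (CommRingCat.ofHom (algebraMap k A)) := by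
    change ((W : Scheme.{u}).isoSpec.inv ≫ W.ι) ≫ b ≫ g = Spec.map (CommRingCat.ofHom ψ)
    rw [Category.assoc]
    change (W : Scheme.{u}).isoSpec.inv ≫ gW = _
    rw [isoSpec_inv_comp]
    rfl
  -- `b` restricted to `W` is an open immersion
  have hWb : IsOpenImmersion (W.ι ≫ b) := by
    have e : W.ι ≫ b = Γ.homOfLE hWU ≫ (b ∣_ U) ≫ U.ι := by
      rw [morphismRestrict_ι, Scheme.homOfLE_ι_assoc]
    rw [e]
    infer_instance
  let j₁ : Spec (.of A) ⟶ Γb := ιW ≫ jΓ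
  let j₂ : Spec (.of A) ⟶ Yb := (W : Scheme.{u}).isoSpec.inv ≫ (W.ι ≫ b) ≫ sY
  haveI : IsOpenImmersion j₁ := inferInstance
  haveI : IsOpenImmersion j₂ := inferInstance
  have hj₁ : j₁ ≫ πΓb = Spec.map (CommRingCat.ofHom (algebraMap k A)) := by
    rw [← hιW]
    change (ιW ≫ jΓ) ≫ c ≫ πYb = _
    rw [Category.assoc, reassoc_of% hfacΓ, hfacY]
  have hj₂ : j₂ ≫ πYb = Spec.map (CommRingCat.ofHom (algebraMap k A)) := by
    rw [← hιW]
    change ((W : Scheme.{u}).isoSpec.inv ≫ (W.ι ≫ b) ≫ sY) ≫ πYb = _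
    simp only [Category.assoc, hfacY]
    rfl
  let MΓ : ProperModel k K := properModelOfChart Γb πΓb A j₁ hj₁
  let MY : ProperModel k K := properModelOfChart Yb πYb A j₂ hj₂
  -- the domination `Γ̄ → Ȳ` as a morphism of models
  have hj₁c : j₁ ≫ c = j₂ := by
    change (ιW ≫ jΓ) ≫ c = (W : Scheme.{u}).isoSpec.inv ≫ (W.ι ≫ b) ≫ sY
    rw [Category.assoc, hfacΓ]
    simp only [ιW, Category.assoc]
  let ch : MΓ.Hom MY :=
    { f := c
      f_π := rfl
      gen_f := by
        change (Spec.map (CommRingCat.ofHom (algebraMap A K)) ≫ j₁) ≫ c =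
          Spec.map (CommRingCat.ofHom (algebraMap A K)) ≫ j₂
        rw [Category.assoc, hj₁c] }
  -- (4) two-model patching and identification of the two dominations
  obtain ⟨N, φ₁, φ₂, -, h₂⟩ := hT k K MΓ MY
  let f₁ : N.X ⟶ Γb := φ₁.f
  haveI : IsProper f₁ := ProperModel.Hom.isProper φ₁
  have hf₁ : IsBirational f₁ := φ₁.isBirational
  have hφ : φ₂.f = f₁ ≫ c := ProperModel.Hom.f_eq φ₂ (φ₁.comp ch)
  -- (5) the patch is regular over `Γ`
  let V : N.X.Opens := f₁ ⁻¹ᵁ jΓ.opensRange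
  have hVreg : Scheme.IsRegular (V : Scheme.{u}) := by
    intro v
    rw [mem_regularLocus_opens_iff]
    apply h₂
    obtain ⟨γ, hγ⟩ := (show f₁ v.1 ∈ Set.range jΓ from v.2)
    have hv2 : φ₂.f v.1 = sY (b γ) := by
      rw [hφ]
      change c (f₁ v.1) = sY (b γ)
      rw [← hγ, ← Scheme.Hom.comp_apply, hfacΓ, Scheme.Hom.comp_apply]
    change IsRegularLocalRing (Yb.presheaf.stalk (φ₂.f v.1))
    rw [hv2]
    haveI := hY (b γ)
    exact IsRegularLocalRing.of_ringEquiv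
      (asIso (sY.stalkMap (b γ))).commRingCatIsoToRingEquiv.symm
  -- (6) restrict the patch over `Γ ≅ jΓ.opensRange`
  have hres : Scheme.HasResolution (jΓ.opensRange : Scheme.{u}) :=
    ⟨(V : Scheme.{u}), f₁ ∣_ jΓ.opensRange,
      ⟨inferInstance, hf₁.morphismRestrict _, hVreg⟩⟩
  exact Scheme.HasResolution.of_iso (Scheme.Hom.isoOpensRange jΓ).inv hres

/-! ## From integral bases to item 24572 verbatim (components of a regular base are clopen) -/

/-- Gluing resolutions of two DISJOINT opens (a clopen decomposition): both inclusions are closed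
immersions, so `ComponentGluing.hasResolution_of_closed_cover` applies. -/
theorem hasResolution_sup_of_disjoint {X : Scheme.{u}} [IsReduced X] (A B : X.Opens)
    (hAB : Disjoint A B) (hA : Scheme.HasResolution (A : Scheme.{u}))
    (hB : Scheme.HasResolution (B : Scheme.{u})) :
    Scheme.HasResolution ((A ⊔ B : X.Opens) : Scheme.{u}) := by
  have hAB' : Disjoint (A : Set X) (B : Set X) := Opens.coe_disjoint.mpr hAB
  let ι₁ : (A : Scheme.{u}) ⟶ (A ⊔ B : X.Opens) := X.homOfLE le_sup_left
  let ι₂ : (B : Scheme.{u}) ⟶ (A ⊔ B : X.Opens) := X.homOfLE le_sup_right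
  have hr₁ : Set.range ι₁ = {z | z.1 ∈ A} := by
    ext z
    constructor
    · rintro ⟨a, rfl⟩
      show (X.homOfLE _ a).1 ∈ A
      rw [Scheme.homOfLE_apply]
      exact a.2
    · intro hz
      refine ⟨⟨z.1, hz⟩, ?_⟩
      apply Subtype.ext
      rw [Scheme.homOfLE_apply]
  have hr₂ : Set.range ι₂ = {z | z.1 ∈ B} := by
    ext z
    constructor
    · rintro ⟨a, rfl⟩
      show (X.homOfLE _ a).1 ∈ B
      rw [Scheme.homOfLE_apply]
      exact a.2
    · intro hz
      refine ⟨⟨z.1, hz⟩, ?_⟩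
      apply Subtype.ext
      rw [Scheme.homOfLE_apply]
  -- every point of `A ⊔ B` is in exactly one of `A`, `B`
  have hmem : ∀ z : ((A ⊔ B : X.Opens) : Scheme.{u}), z.1 ∈ A ∨ z.1 ∈ B := fun z =>
    Opens.mem_sup.mp z.2
  have hc₁ : (Set.range ι₁)ᶜ = Set.range ι₂ := by
    rw [hr₁, hr₂]
    ext z
    simp only [Set.mem_compl_iff, Set.mem_setOf_eq]
    constructor
    · intro h
      exact (hmem z).resolve_left h
    · intro h hA'
      exact Set.disjoint_left.mp hAB' hA' h
  have hc₂ : (Set.range ι₂)ᶜ = Set.range ι₁ := by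
    rw [← hc₁, compl_compl]
  have ho₁ : IsOpen (Set.range ι₁) := ι₁.isOpenEmbedding.isOpen_range
  have ho₂ : IsOpen (Set.range ι₂) := ι₂.isOpenEmbedding.isOpen_range
  have hcl₁ : IsClosed (Set.range ι₁) := by
    rw [← hc₂]
    exact ho₂.isClosed_compl
  have hcl₂ : IsClosed (Set.range ι₂) := by
    rw [← hc₁]
    exact ho₁.isClosed_compl
  haveI : IsClosedImmersion ι₁ := IsClosedImmersion.of_isPreimmersion ι₁ hcl₁
  haveI : IsClosedImmersion ι₂ := IsClosedImmersion.of_isPreimmersion ι₂ hcl₂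
  have hcov : Set.range ι₁ ∪ Set.range ι₂ = Set.univ := by
    rw [← hc₁, Set.union_compl_self]
  have hd₁ : Dense (ι₁ ⁻¹' (Set.range ι₂)ᶜ) := by
    rw [hc₂, Set.preimage_range]
    exact dense_univ
  have hd₂ : Dense (ι₂ ⁻¹' (Set.range ι₁)ᶜ) := by
    rw [hc₁, Set.preimage_range]
    exact dense_univ
  exact ComponentGluing.hasResolution_of_closed_cover ι₁ ι₂ hcov hd₁ hd₂ hA hB

/-- **E2 ⟹ MR** (kernel; item 24572 VERBATIM, Nagata's compactification theorem as a named fact):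
two-model patching of proper models in every characteristic implies `Dominance.SandwichedResolve`.
The base `Y` is regular, hence the disjoint union of its clopen irreducible components
(`Scheme.IsRegular.coe_irreducibleComponentOpen`); over each component the sandwiched scheme is
resolved by `hasResolution_sandwiched_of_twoModelPatching`, and the pieces are glued along the clopen
decomposition (`hasResolution_sup_of_disjoint`). -/
theorem sandwichedResolve_of_twoModelPatching (hN : NagataCompactification.{0})
    (hT : ∀ p : ℕ, p.Prime → ProperModel.TwoModelPatching.{0} p) :
    Dominance.SandwichedResolve := by
  classical
  intro p hp k _ _ Y g hg1 hg2 hg3 hY Γ b hb1 hb2 hb3 hbb hΓ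
  haveI := hg1; haveI := hg2; haveI := hg3; haveI := hb1; haveI := hb2; haveI := hb3; haveI := hΓ
  haveI : IsLocallyNoetherian Y := LocallyOfFiniteType.isLocallyNoetherian g
  haveI : CompactSpace Y := QuasiCompact.compactSpace_of_compactSpace g
  haveI : IsNoetherian Y := {}
  haveI : IsReduced Y := hY.isReduced
  let YC : Set Y → Y.Opens := fun C => Y.irreducibleComponentOpen C
  have hcoe : ∀ C ∈ irreducibleComponents Y, ((YC C : Y.Opens) : Set Y) = C := fun C hC =>
    hY.coe_irreducibleComponentOpen hC
  -- resolution over one component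
  have hone : ∀ C ∈ irreducibleComponents Y,
      Scheme.HasResolution ((b ⁻¹ᵁ (YC C) : Γ.Opens) : Scheme) := by
    intro C hC
    have hirr : IsIrreducible ((YC C : Y.Opens) : Set Y) := by
      rw [hcoe C hC]
      exact hC.1
    haveI : IrreducibleSpace ((YC C : Y.Opens) : Scheme) := Subtype.irreducibleSpace hirr
    haveI : IsIntegral ((YC C : Y.Opens) : Scheme) :=
      isIntegral_of_irreducibleSpace_of_isReduced _
    have hYC : Scheme.IsRegular ((YC C : Y.Opens) : Scheme) := hY.of_isOpenImmersion (YC C).ι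
    have hbC : IsBirational (b ∣_ (YC C)) := hbb.morphismRestrict _
    haveI : IrreducibleSpace ((b ⁻¹ᵁ (YC C) : Γ.Opens) : Scheme) :=
      ComponentGluing.IsBirational.irreducibleSpace hbC
    haveI : IsIntegral ((b ⁻¹ᵁ (YC C) : Γ.Opens) : Scheme) :=
      isIntegral_of_irreducibleSpace_of_isReduced _
    exact hasResolution_sandwiched_of_twoModelPatching hN (hT p hp) ((YC C).ι ≫ g) hYC
      (b ∣_ (YC C)) hbC
  -- induction over finite sets of components
  have key : ∀ S : Finset (Set Y), (↑S : Set (Set Y)) ⊆ irreducibleComponents Y →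
      Scheme.HasResolution ((b ⁻¹ᵁ (⨆ C ∈ S, YC C) : Γ.Opens) : Scheme) := by
    intro S
    induction S using Finset.induction_on with
    | empty =>
      intro _
      have e : (⨆ C ∈ (∅ : Finset (Set Y)), YC C : Y.Opens) = ⊥ := by simp
      rw [e, Scheme.Hom.preimage_bot]
      apply Scheme.IsRegular.hasResolution
      intro x
      have hx : x.1 ∈ ((⊥ : Γ.Opens) : Set Γ) := x.2
      rw [Opens.coe_bot] at hx
      exact (Set.notMem_empty _ hx).elim
    | insert C S hCS ih =>
      intro hsub
      have hC : C ∈ irreducibleComponents Y := hsub (Finset.mem_insert_self C S)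
      have hS : (↑S : Set (Set Y)) ⊆ irreducibleComponents Y := fun D hD =>
        hsub (Finset.mem_insert_of_mem hD)
      rw [Finset.iSup_insert, Scheme.Hom.preimage_sup]
      refine hasResolution_sup_of_disjoint _ _ ?_ (hone C hC) (ih hS)
      -- disjointness: components of a regular scheme are disjoint
      rw [← Opens.coe_disjoint]
      refine Set.disjoint_left.mpr fun x hx hx' => ?_
      have h1 : b x ∈ (YC C : Y.Opens) := hx
      have h2 : b x ∈ ((⨆ D ∈ S, YC D : Y.Opens) : Set Y) := hx'
      simp only [Opens.coe_iSup, Set.mem_iUnion] at h2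
      obtain ⟨D, hD, h2⟩ := h2
      have hDc : D ∈ irreducibleComponents Y := hS hD
      have e1 : b x ∈ C := by rw [← hcoe C hC]; exact h1
      have e2 : b x ∈ D := by rw [← hcoe D hDc]; exact h2
      have := hY.eq_of_mem_irreducibleComponents (b x) hC hDc e1 e2
      exact hCS (this ▸ hD)
  -- all components cover `Y`
  have hfin : (irreducibleComponents Y).Finite := NoetherianSpace.finite_irreducibleComponents
  have htop : (⨆ C ∈ hfin.toFinset, YC C : Y.Opens) = ⊤ := by
    refine top_le_iff.mp fun y _ => ?_
    simp only [Opens.mem_iSup]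
    refine ⟨irreducibleComponent y, hfin.mem_toFinset.mpr
      (irreducibleComponent_mem_irreducibleComponents y), ?_⟩
    show y ∈ ((YC (irreducibleComponent y) : Y.Opens) : Set Y)
    rw [hcoe _ (irreducibleComponent_mem_irreducibleComponents y)]
    exact mem_irreducibleComponent
  have hall := key hfin.toFinset fun C hC => hfin.mem_toFinset.mp hC
  have htop' : (b ⁻¹ᵁ (⨆ C ∈ hfin.toFinset, YC C) : Γ.Opens) = ⊤ := by
    rw [htop, Scheme.Hom.preimage_top]
  have hall' : Scheme.HasResolution ((⊤ : Γ.Opens) : Scheme) := by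
    rw [← htop']
    exact hall
  exact Scheme.HasResolution.of_iso Γ.topIso.hom hall'

end Summit.ResolutionOfSingularities.ResolutionOfSingularities.Theorems.DominanceOfTwoModelPatching

end
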